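import Summits.HodgeConjecture.CorCM.MultiFieldWeilTwinsRealised
import Summits.HodgeConjecture.CorCM.MultiFieldWeilTwinSextics
import HarnessLib

/-!
# MULTI-FIELD WEIL ENGINE — SEVERAL SEXTIC TWIN PAIRS: `E` + ANY NUMBER of pairs of non-isogenous simple CM threefolds over ONE sextic field each + simple threefolds over
# further sextic fields, all through `k`, the fields pairwise non-isomorphic — the Hodge conjecture for every product of copies, given ONLY Markman's fourfold theorem

Cell `pub-hodgecm2` (COR-CM), seat b30 gen 37 (2026-08-25); count-neutral own lane MULTI-FIELD WEIL ENGINE (stem `MultiFieldWeil*`), sequel of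
`CorCM/MultiFieldWeilTwinsRealised.lean` (T2b: frame form with several twin pairs) in the pattern of `CorCM/MultiFieldWeilTwinSextics.lean` §2 (T3: ONE pair).  Theorems
only; no definition, no named fact, no `sorry`.  HONEST FRAMING: conditional on `Markman2025_weilClasses_algebraic_abelianFourfold` (displayed binder `hW4`); `HC_CM` is NOT
proved and not asserted.

**`hodgeConjectureFor_biproduct_comp_of_simpleSexticTwinPairs_of_isEmpty_ringHom`** — GENERAL INDEXING.  Slots `Fin r` over `is : Fin r → I`, every `K_m = Kf (is m)` SEXTIC
and receiving `k = Kf i₀` (imaginary quadratic) along `iK`; `E = A 0 ⊨ (k; {τ})`; `B_m = A (m+1)` SIMPLE CM threefolds over `K_m`, NO hypothesis on their types.  The TWIN PAIRS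
are the `2`-element fibres `{m, tw m}` of an involution `tw` of the slots: SAME index (`is (tw m) = is m`, so the same field and the same embedding of `k`) and `B_m ≁ B_{tw m}`;
slots in different fibres have `Hom(K_m, K_{m₀}) = ∅`.  Then the Hodge conjecture holds for EVERY product of copies `⨁_j A(κ j)` — in particular for
`E × ∏_j (B_j × B_j') × ∏ T_m` with SEVERAL doubled sextic fields `K_j ∋ k` —, GIVEN ONLY Markman's fourfold theorem; dominated form.
PROOF.  Normalise every threefold structure to ONE member over `τ` (`exists_realisations_of_forall_succ`); choose ONE frame PER INDEX: at a doubled index gen 14's dihedral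
frame `DihedralSexticPair.exists_frame_of_card_fibre_eq_one` reading the two (different, `cmType_ne_and_ne_compl_of_not_isIsogenous`; `K` not Galois,
`not_isGalois_of_isSimple_of_not_isIsogenous`) normalised types at the places `0` (smaller slot) and `1` (larger slot), the six maps `x ↦ ±x + j` realised
(`exists_affine_zmod3`); elsewhere a sign frame.  Frames per index make the realised tuples DIAGONAL on every pair outright; the partner's structure is moved across the index
equality by substitution (`HEq` bookkeeping, no transport of abelian varieties).  Cross conditions from `Hom = ∅` (W1 §3); then T2b `hodgeConjectureFor_biproduct_comp_of_twins_frames`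
with the intrinsic Markman supplier `weilHyp_of_markman_fourfold_intrinsic`.  NOT covered (honest limits): a THIRD type of one field (the face class obstructs); a sister
field `k′·K⁺`; non-isomorphic fields of different pairs sharing a Galois closure is allowed here ONLY through `Hom = ∅` (which is what the proof uses).
[cite: Markman2025SurveySecant, Thm. 1.2] [cite: Shimura1998, §6.1 Corollary of Theorem 2, §8.2 Prop. 26, §18.2] [cite: Lang2002, VI §1 Thm. 1.14] [cite: Pohlmann1968, Thm 1]
[cite: MoonenZarhin1995Duke, Thm. 2.4] [cite: DixonMortimer1996, §1.6, Thm. 1.6A; §2.1]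

## References
* [Markman2025SurveySecant] E. Markman, arXiv:2509.23403, Thm. 1.2.  [Pohlmann1968] H. Pohlmann, Ann. of Math. 88 (1968), Thm 1.  [MoonenZarhin1995Duke] B. Moonen, Yu. Zarhin,
  Duke Math. J. 77 (1995), Thm. 2.4.  [DixonMortimer1996] J. D. Dixon, B. Mortimer, *Permutation Groups*, GTM 163.  [Shimura1998] G. Shimura, CM book, §18.2.  [Lang2002] S. Lang,
  *Algebra*, VI §1.
-/

noncomputable section

open CategoryTheory CategoryTheory.Limits NumberField IntermediateField

namespace Summit.HodgeConjecture.CorCM.MultiFieldWeil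

open Finset
open Literature.AlgebraicGeometry Literature.AlgebraicGeometry.Motives Literature.AlgebraicGeometry.HodgeTheory
open Literature.AlgebraicGeometry.ComplexMultiplication (IsCMTypeRealisation)
open Literature.AlgebraicTopology.SingularHomology
open Literature.NumberTheory.ComplexMultiplication
open Summit.HodgeConjecture.CorCM.Census.MultiFieldWeil

open scoped Classical

section TwinPairs

variable {I : Type} {r : ℕ} {Kf : I → Type} [∀ i, Field (Kf i)] [∀ i, NumberField (Kf i)] [∀ i, IsCMField (Kf i)]
  {i₀ : I} {is : Fin r → I} {τ : Kf i₀ →+* ℂ}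
  {A : Fin (r + 1) → AbelianVariety ℂ} {Φ : ∀ j : Fin (r + 1), CMType (Kf (mfSlots i₀ is j))}
  {ι : ∀ j, 𝓞 (Kf (mfSlots i₀ is j)) →+* End (A j)}
  {θ : ∀ j, Kf (mfSlots i₀ is j) →+* Module.End ℂ (complexBetti (A j).X 1)}

/-- **SEVERAL SEXTIC TWIN PAIRS, SIMPLE FORM — `E` + pairs `B_m ≁ B_{tw m}` of SIMPLE CM threefolds over ONE sextic CM field `K_m ∋ k` each + SIMPLE CM threefolds over further
sextic CM fields through `k`, `Hom = ∅` between the fields of different units: the Hodge conjecture for EVERY product of copies, GIVEN ONLY Markman's fourfold theorem.**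
See the module docstring (general indexing `is : Fin r → I`, twin pairs = fibres of the involution `tw` with `is (tw m) = is m`).  `HC_CM` is NOT asserted.
[cite: Markman2025SurveySecant, Thm. 1.2] [cite: Shimura1998, §6.1 Corollary of Theorem 2, §8.2 Prop. 26, §18.2] [cite: Lang2002, VI §1 Thm. 1.14]
[cite: MoonenZarhin1995Duke, Thm. 2.4] [cite: DixonMortimer1996, §1.6, Thm. 1.6A; §2.1] -/
theorem hodgeConjectureFor_biproduct_comp_of_simpleSexticTwinPairs_of_isEmpty_ringHom (hW4 : Markman2025_weilClasses_algebraic_abelianFourfold)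
    {N : ℕ} (κ : Fin N → Fin (r + 1)) (h2 : Module.finrank ℚ (Kf i₀) = 2) (h6 : ∀ m : Fin r, Module.finrank ℚ (Kf (is m)) = 6)
    (iK : ∀ i : I, Kf i₀ →+* Kf i) (hA : ∀ j, IsCMTypeRealisation (Φ j) (A j) (ι j) (θ j)) (hΨ : ∀ σ : Kf i₀ →+* ℂ, σ ∈ (Φ 0).1 ↔ σ = τ)
    (hS : ∀ m : Fin r, (A m.succ).IsSimple)
    (tw : Fin r → Fin r) (htw : ∀ m, tw (tw m) = m) (hι : ∀ m, is (tw m) = is m)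
    (hni : ∀ m, tw m ≠ m → ¬ AbelianVariety.IsIsogenous (A m.succ) (A (tw m).succ))
    (hiso : ∀ m₀ m : Fin r, m₀ ≠ m → tw m₀ ≠ m → IsEmpty (Kf (is m) →+* Kf (is m₀))) :
    HodgeConjectureFor (⨁ fun j => A (κ j)).dim (⨁ fun j => A (κ j)).X := by
  have hττ : ComplexEmbedding.conjugate τ ≠ τ := QuarticCM.conjugate_ne τ
  have hk : ∀ σ : Kf i₀ →+* ℂ, σ = τ ∨ σ = ComplexEmbedding.conjugate τ := fun σ => QuarticCM.eq_or_eq_conjugate_of_quadratic h2 τ σ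
  obtain ⟨δ₀, d, hd, hδ₀⟩ := CyclicSextic.exists_sq_eq_neg_nat_of_isTotallyComplex (Kf i₀) h2
  obtain ⟨δ, hδ, hτ⟩ := OcticCurveFourfold.exists_delta_of_mem h2 hd hδ₀ τ
  let im : ∀ m : Fin r, Kf i₀ →+* Kf (is m) := fun m => iK (is m)
  -- (0) transport across an equality of indices, by substitution
  have homT : ∀ i j : I, i = j → Nonempty (Kf i →+* Kf j) := fun i j h => by subst h; exact ⟨RingHom.id _⟩
  have castT : ∀ i j : I, i = j → ∀ (Ψ : CMType (Kf i)) (B : AbelianVariety ℂ) (ιB : 𝓞 (Kf i) →+* End B)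
      (θB : Kf i →+* Module.End ℂ (complexBetti B.X 1)), IsCMTypeRealisation Ψ B ιB θB →
      ∃ (Ψ₂ : CMType (Kf j)) (ι₂ : 𝓞 (Kf j) →+* End B) (θ₂ : Kf j →+* Module.End ℂ (complexBetti B.X 1)), HEq Ψ₂ Ψ ∧ IsCMTypeRealisation Ψ₂ B ι₂ θ₂ := by
    intro i j h; subst h; exact fun Ψ B ιB θB hB => ⟨Ψ, ιB, θB, HEq.rfl, hB⟩
  have countT : ∀ i j : I, i = j → ∀ (Ψ : CMType (Kf i)) (Ψ₂ : CMType (Kf j)), HEq Ψ₂ Ψ →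
      (Finset.univ.filter fun s : Kf i →+* ℂ => s.comp (iK i) = τ ∧ s ∈ Ψ.1).card = 1 →
      (Finset.univ.filter fun s : Kf j →+* ℂ => s.comp (iK j) = τ ∧ s ∈ Ψ₂.1).card = 1 := by
    intro i j h; subst h; intro Ψ Ψ₂ hh; cases hh; exact id
  have heqT : ∀ i j : I, i = j → ∀ Ψ : CMType (Kf i), ∃ Ψ₂ : CMType (Kf j), HEq Ψ₂ Ψ := by
    intro i j h; subst h; exact fun Ψ => ⟨Ψ, HEq.rfl⟩
  -- (1) every threefold structure with ONE member over `τ`, on the same varieties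
  obtain ⟨Φ', ι', θ', hA', h0, h1⟩ := exists_realisations_of_forall_succ (is := is) hA
    (fun m Φ' => (Finset.univ.filter fun s : Kf (is m) →+* ℂ => s.comp (im m) = τ ∧ s ∈ Φ'.1).card = 1)
    (fun m => exists_realisation_card_eq_one (h6 m) h2 (im m) (hA m.succ) τ (card_filter_mem_eq_one_or_two_of_isSimple (h6 m) h2 (im m) (hA m.succ) (hS m) τ))
  have hΨ' : ∀ σ : Kf i₀ →+* ℂ, σ ∈ (Φ' 0).1 ↔ σ = τ := by rw [h0]; exact hΨ
  have slotT : ∀ a b : Fin r, a = b → HEq (Φ' a.succ) (Φ' b.succ) := fun a b h => by subst h; exact HEq.rfl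
  -- (2) two slots with a common index lie in one unit
  have hunit : ∀ m₀ m : Fin r, is m = is m₀ → m = m₀ ∨ m = tw m₀ := by
    intro m₀ m h
    by_contra hne
    push Not at hne
    exact (hiso m₀ m (Ne.symm hne.1) (Ne.symm hne.2)).false (Classical.choice (homT _ _ h))
  have hprim_or : ∀ m, tw m ≠ m → (m : ℕ) < (tw m : ℕ) ∨ (tw m : ℕ) < (m : ℕ) := fun m h => by
    rcases lt_trichotomy (m : ℕ) (tw m : ℕ) with h' | h' | h'
    · exact Or.inl h'
    · exact absurd (Fin.ext h').symm h
    · exact Or.inr h'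
  -- (3) ONE frame PER INDEX: dihedral at the doubled indices (smaller slot's type at `0`, larger slot's at `1`), a sign frame elsewhere
  have hfr : ∀ i : I, Module.finrank ℚ (Kf i) = 6 → ∃ E : (Kf i →+* ℂ) ≃ Fin 3 × Bool,
      (∀ s, (E s).2 = true ↔ s.comp (iK i) = τ) ∧ (∀ s, E (ComplexEmbedding.conjugate s) = ((E s).1, !(E s).2)) ∧
      ∀ p : Fin r, is p = i → tw p ≠ p → (p : ℕ) < (tw p : ℕ) →
        (∀ a a' b b' : Fin 3, a ≠ a' → b ≠ b' → ∃ σ : ℂ ≃+* ℂ, (σ : ℂ →+* ℂ).comp τ = τ ∧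
          (σ : ℂ →+* ℂ).comp (E.symm (a, true)) = E.symm (b, true) ∧ (σ : ℂ →+* ℂ).comp (E.symm (a', true)) = E.symm (b', true)) ∧
        (∀ Ψ₁ : CMType (Kf i), HEq Ψ₁ (Φ' p.succ) → ∀ s, s ∈ Ψ₁.1 ↔ (E s).2 = decide ((E s).1 = 0)) ∧
        (∀ Ψ₂ : CMType (Kf i), HEq Ψ₂ (Φ' (tw p).succ) → ∀ s, s ∈ Ψ₂.1 ↔ (E s).2 = decide ((E s).1 = 1)) := by
    intro i h6i
    by_cases hx : ∃ p : Fin r, is p = i ∧ tw p ≠ p ∧ (p : ℕ) < (tw p : ℕ)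
    · obtain ⟨p, rfl, htp, hlt⟩ := hx
      -- the partner's structure, read over the common index
      obtain ⟨Ψ₂, ι₂, θ₂, hh₂, hA₂⟩ := castT _ _ (hι p) (Φ' (tw p).succ) (A (tw p).succ) (ι' (tw p).succ) (θ' (tw p).succ) (hA' (tw p).succ)
      have hone₂ := countT _ _ (hι p) (Φ' (tw p).succ) Ψ₂ hh₂ (h1 (tw p))
      have hK : ¬ IsGalois ℚ (Kf (is p)) :=
        SexticCMThreefoldPair.not_isGalois_of_isSimple_of_not_isIsogenous (h6 p) h2 (iK (is p)) (hA' p.succ) hA₂ (hS p) (hS (tw p)) (hni p htp)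
      have hne : (Φ' p.succ).1 ≠ Ψ₂.1 := (DihedralSexticPair.cmType_ne_and_ne_compl_of_not_isIsogenous (hA' p.succ) hA₂ (hni p htp)).1
      have hdich : ∀ s : Kf (is p) →+* ℂ, s.comp (iK (is p)) = τ ∨ s.comp (iK (is p)) = ComplexEmbedding.conjugate τ := fun s => hk _
      let Φ₂ : Fin 2 → CMType (Kf (is p)) := Fin.cons (Φ' p.succ) fun _ => Ψ₂
      have hone : ∀ j : Fin 2, (Finset.univ.filter fun s : Kf (is p) →+* ℂ => s.comp (iK (is p)) = τ ∧ s ∈ (Φ₂ j).1).card = 1 :=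
        Fin.forall_fin_two.2 ⟨h1 p, hone₂⟩
      have hne₂ : (Φ₂ 0).1 ≠ (Φ₂ 1).1 := hne
      obtain ⟨E, he_conj, he_sign', he_gal, hΦe⟩ := DihedralSexticPair.exists_frame_of_card_fibre_eq_one hττ hdich hK (h6 p) (Φ := Φ₂) hone hne₂
      have he_sign : ∀ s : Kf (is p) →+* ℂ, (E s).2 = true ↔ s.comp (iK (is p)) = τ := fun s => (he_sign' s).symm
      -- `2`-transitivity over `τ`
      have hgal : ∀ a a' b b' : Fin 3, a ≠ a' → b ≠ b' → ∃ σ : ℂ ≃+* ℂ, (σ : ℂ →+* ℂ).comp τ = τ ∧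
          (σ : ℂ →+* ℂ).comp (E.symm (a, true)) = E.symm (b, true) ∧ (σ : ℂ →+* ℂ).comp (E.symm (a', true)) = E.symm (b', true) := by
        intro a a' b b' haa hbb
        obtain ⟨j, f, hb, hb'⟩ := exists_affine_zmod3 a a' b b' haa hbb
        obtain ⟨σ, hσ⟩ := he_gal j f
        have hmove : ∀ x : ZMod 3, (σ : ℂ →+* ℂ).comp (E.symm (x, true)) = E.symm ((if f then -x else x) + j, true) := fun x => by
          have h := hσ (E.symm (x, true))
          rw [Equiv.apply_symm_apply] at h
          rw [← h, Equiv.symm_apply_apply]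
        refine ⟨σ, ?_, by rw [hmove a, hb], by rw [hmove a', hb']⟩
        have hs : (E.symm (0, true)).comp (iK (is p)) = τ := (he_sign _).1 (by rw [Equiv.apply_symm_apply])
        have hs' : (E.symm ((if f then -0 else 0) + j, true)).comp (iK (is p)) = τ := (he_sign _).1 (by rw [Equiv.apply_symm_apply])
        calc (σ : ℂ →+* ℂ).comp τ = ((σ : ℂ →+* ℂ).comp (E.symm (0, true))).comp (iK (is p)) := by rw [RingHom.comp_assoc, hs]
          _ = τ := by rw [hmove 0, hs']
      have hv0 : ∀ x : ZMod 3, x.val = (0 : Fin 2).val ↔ x = 0 := by decide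
      have hv1 : ∀ x : ZMod 3, x.val = (1 : Fin 2).val ↔ x = 1 := by decide
      have hrd0 : ∀ s : Kf (is p) →+* ℂ, s ∈ (Φ' p.succ).1 ↔ (E s).2 = decide ((E s).1 = 0) := fun s => by
        refine (hΦe 0 s).trans ?_
        rw [decide_eq_decide.2 (hv0 _)]
      have hrd1 : ∀ s : Kf (is p) →+* ℂ, s ∈ Ψ₂.1 ↔ (E s).2 = decide ((E s).1 = 1) := fun s => by
        refine (hΦe 1 s).trans ?_
        rw [decide_eq_decide.2 (hv1 _)]
      refine ⟨E, he_sign, he_conj, fun p' hp' htp' hlt' => ?_⟩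
      obtain rfl : p' = p := by
        rcases hunit p p' hp' with h | h
        · exact h
        · exfalso
          rw [h, htw] at hlt'
          omega
      refine ⟨hgal, fun Ψ₁ hh s => ?_, fun Ψ hh s => ?_⟩
      · have hΨ₁ : Ψ₁ = Φ' p'.succ := eq_of_heq hh
        subst hΨ₁
        exact hrd0 s
      · have hΨ : Ψ = Ψ₂ := eq_of_heq (hh.trans hh₂.symm)
        subst hΨ
        exact hrd1 s
    · obtain ⟨E, he_sign, he_conj⟩ := exists_signFrame (n := 3) (by rw [h6i]) h2 (iK i) hττ hk
      exact ⟨E, he_sign, he_conj, fun p hp htp hlt => absurd ⟨p, hp, htp, hlt⟩ hx⟩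
  choose E hE_sign hE_conj hE_twin using hfr
  -- transports with the frames in place
  have galT : ∀ i j : I, i = j → ∀ (hi : Module.finrank ℚ (Kf i) = 6) (hj : Module.finrank ℚ (Kf j) = 6),
      (∀ a a' b b' : Fin 3, a ≠ a' → b ≠ b' → ∃ σ : ℂ ≃+* ℂ, (σ : ℂ →+* ℂ).comp τ = τ ∧
        (σ : ℂ →+* ℂ).comp ((E i hi).symm (a, true)) = (E i hi).symm (b, true) ∧ (σ : ℂ →+* ℂ).comp ((E i hi).symm (a', true)) = (E i hi).symm (b', true)) →
      ∀ a a' b b' : Fin 3, a ≠ a' → b ≠ b' → ∃ σ : ℂ ≃+* ℂ, (σ : ℂ →+* ℂ).comp τ = τ ∧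
        (σ : ℂ →+* ℂ).comp ((E j hj).symm (a, true)) = (E j hj).symm (b, true) ∧ (σ : ℂ →+* ℂ).comp ((E j hj).symm (a', true)) = (E j hj).symm (b', true) := by
    intro i j h; subst h; exact fun _ _ hg => hg
  have readT : ∀ i j : I, i = j → ∀ (hi : Module.finrank ℚ (Kf i) = 6) (hj : Module.finrank ℚ (Kf j) = 6) (Ψ : CMType (Kf i)) (Ψ₂ : CMType (Kf j)) (q : Fin 3),
      HEq Ψ₂ Ψ → (∀ s, s ∈ Ψ₂.1 ↔ (E j hj s).2 = decide ((E j hj s).1 = q)) → ∀ s, s ∈ Ψ.1 ↔ (E i hi s).2 = decide ((E i hi s).1 = q) := by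
    intro i j h; subst h
    intro hi hj Ψ Ψ₂ q hh hr
    have hΨ : Ψ₂ = Ψ := eq_of_heq hh
    subst hΨ
    exact hr
  have diagT : ∀ i j : I, i = j → ∀ (hi : Module.finrank ℚ (Kf i) = 6) (hj : Module.finrank ℚ (Kf j) = 6) (ρ : ℂ →+* ℂ) (a x y : Fin 3),
      ρ.comp ((E i hi).symm (a, true)) = (E i hi).symm (x, true) → ρ.comp ((E j hj).symm (a, true)) = (E j hj).symm (y, true) → x = y := by
    intro i j h; subst h
    intro hi hj ρ a x y h₁ h₂
    exact (Prod.mk.inj ((E i hi).symm.injective (h₁.symm.trans h₂))).1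
  -- (4) the frames of the slots and their readings
  let e : ∀ m : Fin r, (Kf (is m) →+* ℂ) ≃ Fin 3 × Bool := fun m => E (is m) (h6 m)
  have he_sign : ∀ (m : Fin r) (s : Kf (is m) →+* ℂ), (e m s).2 = true ↔ s.comp (im m) = τ := fun m => hE_sign (is m) (h6 m)
  have he_conj : ∀ (m : Fin r) (s : Kf (is m) →+* ℂ), e m (ComplexEmbedding.conjugate s) = ((e m s).1, !(e m s).2) := fun m => hE_conj (is m) (h6 m)
  have hgal : ∀ m, tw m ≠ m → ∀ a a' b b' : Fin 3, a ≠ a' → b ≠ b' → ∃ σ : ℂ ≃+* ℂ, (σ : ℂ →+* ℂ).comp τ = τ ∧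
      (σ : ℂ →+* ℂ).comp ((e m).symm (a, true)) = (e m).symm (b, true) ∧ (σ : ℂ →+* ℂ).comp ((e m).symm (a', true)) = (e m).symm (b', true) := by
    intro m htm
    rcases hprim_or m htm with hlt | hlt
    · exact (hE_twin (is m) (h6 m) m rfl htm hlt).1
    · have htm' : tw (tw m) ≠ tw m := by rw [htw]; exact htm.symm
      have hlt' : ((tw m : Fin r) : ℕ) < (tw (tw m) : ℕ) := by rw [htw]; exact hlt
      exact galT _ _ (hι m) (h6 (tw m)) (h6 m) (hE_twin (is (tw m)) (h6 (tw m)) (tw m) rfl htm' hlt').1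
  have hread : ∀ m, tw m ≠ m → ∀ s : Kf (is m) →+* ℂ,
      s ∈ (Φ' m.succ).1 ↔ (e m s).2 = decide ((e m s).1 = if (m : ℕ) < (tw m : ℕ) then (0 : Fin 3) else 1) := by
    intro m htm
    rcases hprim_or m htm with hlt | hlt
    · rw [if_pos hlt]
      exact (hE_twin (is m) (h6 m) m rfl htm hlt).2.1 (Φ' m.succ) HEq.rfl
    · rw [if_neg (lt_asymm hlt)]
      have htm' : tw (tw m) ≠ tw m := by rw [htw]; exact htm.symm
      have hlt' : ((tw m : Fin r) : ℕ) < (tw (tw m) : ℕ) := by rw [htw]; exact hlt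
      obtain ⟨Ψ₂, hh⟩ := heqT _ _ (hι m).symm (Φ' m.succ)
      have hh' : HEq Ψ₂ (Φ' (tw (tw m)).succ) := hh.trans (slotT _ _ (htw m).symm)
      exact readT _ _ (hι m).symm (h6 m) (h6 (tw m)) (Φ' m.succ) Ψ₂ 1 hh ((hE_twin (is (tw m)) (h6 (tw m)) (tw m) rfl htm' hlt').2.2 Ψ₂ hh')
  -- position sets
  let P : ∀ m : Fin r, Finset (Fin 3) := fun m => Finset.univ.filter fun a : Fin 3 => (e m).symm (a, true) ∈ (Φ' m.succ).1
  have hΦ : ∀ (m : Fin r) (s : Kf (is m) →+* ℂ), s ∈ (Φ' m.succ).1 ↔ (e m s).2 = decide ((e m s).1 ∈ P m) := fun m s =>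
    mem_iff_snd_eq_decide_mem_posSet (he_conj m) (Φ' m.succ) s
  have hcard : ∀ m : Fin r, (P m).card = 1 := fun m => (card_posSet (he_sign m) (Φ' m.succ)).trans (h1 m)
  let q : ∀ m : Fin r, Fin 3 := fun m => if (m : ℕ) < (tw m : ℕ) then 0 else 1
  have hPq : ∀ m, tw m ≠ m → P m = {q m} := by
    intro m htm
    ext a
    rw [Finset.mem_singleton, Finset.mem_filter, hread m htm, Equiv.apply_symm_apply]
    simp only [Finset.mem_univ, true_and, true_eq_decide_iff, q]
  have hq : ∀ m, tw m ≠ m → Fin.cast rfl (q (tw m)) ≠ q m := by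
    intro m htm
    show q (tw m) ≠ q m
    simp only [q, htw]
    rcases hprim_or m htm with hlt | hlt
    · rw [if_neg (lt_asymm hlt), if_pos hlt]; decide
    · rw [if_pos hlt, if_neg (lt_asymm hlt)]; decide
  -- (5) the realised tuples are DIAGONAL on every pair and `2`-transitive there
  have hdg : ∀ π ∈ realisedTuples e τ, ∀ m, tw m ≠ m → ∀ a : Fin 3, π (tw m) a = π m a := by
    intro π hπ m _ a
    obtain ⟨ρ, -, hρ⟩ := (mem_realisedTuples e τ π).1 hπ
    exact diagT _ _ (hι m) (h6 (tw m)) (h6 m) (ρ : ℂ →+* ℂ) a (π (tw m) a) (π m a) (hρ (tw m) a) (hρ m a)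
  have h2t : ∀ m, tw m ≠ m → ∀ a a' b b' : Fin 3, a ≠ a' → b ≠ b' → ∃ π ∈ realisedTuples e τ, π m a = b ∧ π m a' = b' := by
    intro m htm a a' b b' haa hbb
    obtain ⟨σ, hστ, hσa, hσa'⟩ := hgal m htm a a' b b' haa hbb
    obtain ⟨π, hπ, hπσ⟩ := exists_mem_realisedTuples_of_comp_tau_eq (e := e) he_sign σ hστ
    have ha : (σ : ℂ →+* ℂ).comp ((e m).symm (a, true)) = (e m).symm (π m a, true) := hπσ m a
    have ha' : (σ : ℂ →+* ℂ).comp ((e m).symm (a', true)) = (e m).symm (π m a', true) := hπσ m a'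
    exact ⟨π, hπ, (Prod.mk.inj ((e m).symm.injective (ha.symm.trans hσa))).1, (Prod.mk.inj ((e m).symm.injective (ha'.symm.trans hσa'))).1⟩
  -- (6) stabiliser-transitivity across units, from `Hom = ∅` (one value outside a Galois closure, W1)
  have hexs : ∀ m : Fin r, ∃ s : Kf (is m) →+* ℂ, s.comp (im m) = τ := fun m => by
    obtain ⟨s, hs⟩ := Finset.card_pos.1 (by rw [h1 m]; exact Nat.one_pos)
    exact ⟨s, (Finset.mem_filter.1 hs).2.1⟩
  have hstab : ∀ (m₀ m : Fin r), m₀ ≠ m → tw m₀ ≠ m → ∀ a a' : Fin 3, ∃ ν ∈ realisedTuples e τ, ν m₀ = 1 ∧ ν (tw m₀) = 1 ∧ ν m a = a' := by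
    intro m₀ m h₁ h₂ a a'
    obtain ⟨s, hs⟩ := hexs m
    have hout : ∃ s : Kf (is m) →+* ℂ, s.comp (im m) = τ ∧ ∃ x, s x ∉ normalClosure ℚ (Kf (is m₀)) ℂ :=
      ⟨s, hs, exists_apply_not_mem_normalClosure_of_isEmpty_ringHom h2 im (h6 m₀) (h6 m) (hiso m₀ m h₁ h₂) s hs⟩
    obtain ⟨ν, hν, hν0, hνa⟩ := stabTransitive_realisedTuples_of_outside_prime (e := e) he_sign m₀ m Nat.prime_three hout a a'
    refine ⟨ν, hν, hν0, ?_, hνa⟩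
    by_cases ht : tw m₀ = m₀
    · rw [ht]; exact hν0
    · ext b
      have hb := hdg ν hν m₀ ht b
      rw [hν0] at hb
      exact congrArg Fin.val hb
  -- (7) the engine with several twin pairs, the single-slot Weil planes from Markman's fourfold theorem
  exact hodgeConjectureFor_biproduct_comp_of_twins_frames (is := is) (n := fun _ => 3) P (fun _ => 1) hcard (fun _ => Nat.prime_three) (fun _ => Nat.one_pos)
    (fun _ => by norm_num) κ h2 im hτ hA' e he_sign he_conj hΨ' hΦ tw htw (fun _ => rfl) (fun _ _ => le_rfl) (fun π hπ m htm a => hdg π hπ m htm a) h2t hstab q hPq hq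
    fun m => weilHyp_of_markman_fourfold_intrinsic hW4 m (h6 m) h2 hd hδ hA' hΨ' (h1 m)

/-- **Dominated form.** [cite: Markman2025SurveySecant, Thm. 1.2] [cite: MumfordAV1970, §19 Thm. 1 and p. 169] -/
theorem hodgeConjectureFor_of_avDominatedBy_comp_of_simpleSexticTwinPairs_of_isEmpty_ringHom (hW4 : Markman2025_weilClasses_algebraic_abelianFourfold)
    {N : ℕ} (κ : Fin N → Fin (r + 1)) (h2 : Module.finrank ℚ (Kf i₀) = 2) (h6 : ∀ m : Fin r, Module.finrank ℚ (Kf (is m)) = 6)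
    (iK : ∀ i : I, Kf i₀ →+* Kf i) (hA : ∀ j, IsCMTypeRealisation (Φ j) (A j) (ι j) (θ j)) (hΨ : ∀ σ : Kf i₀ →+* ℂ, σ ∈ (Φ 0).1 ↔ σ = τ)
    (hS : ∀ m : Fin r, (A m.succ).IsSimple)
    (tw : Fin r → Fin r) (htw : ∀ m, tw (tw m) = m) (hι : ∀ m, is (tw m) = is m)
    (hni : ∀ m, tw m ≠ m → ¬ AbelianVariety.IsIsogenous (A m.succ) (A (tw m).succ))
    (hiso : ∀ m₀ m : Fin r, m₀ ≠ m → tw m₀ ≠ m → IsEmpty (Kf (is m) →+* Kf (is m₀)))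
    {X : AbelianVariety ℂ} (hX : Domination.AVDominatedBy X (⨁ fun j => A (κ j))) : HodgeConjectureFor X.dim X.X :=
  Domination.hodgeConjectureFor_of_avDominatedBy
    (hodgeConjectureFor_biproduct_comp_of_simpleSexticTwinPairs_of_isEmpty_ringHom hW4 κ h2 h6 iK hA hΨ hS tw htw hι hni hiso) hX

end TwinPairs

end Summit.HodgeConjecture.CorCM.MultiFieldWeil

end
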